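import Summits.BirchSwinnertonDyer.BirchSwinnertonDyer.Theorems.AdditiveBranchIMCGordTwoRankOneHeegnerKolyvaginSelfTwist
import Literature.NumberTheory.EllipticCurves.KolyvaginShaIndexBound
import HarnessLib

/-!
# Route `AdditiveBranchIMC` (rung K1), crux `GordTwoRankOne` (item 19358): the HEIGHT-FREE
# Heegner–Kolyvagin road — Part 21b: the two halves of `BSD(E^{(d_K)},p)` for the rank-one TWIST of a
# rank-zero parametrised curve (self-twist / ramified Heegner frame; cell `bsd-addord`, second prover
# lane `bsd-addord-k1-c3x`, gen 5; `--supports 19358 --as helper` only)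

HONEST FRAMING. THEOREMS ONLY: no definition, no new named fact, no `sorry`; nothing is booked; BSD is
not proved by any of this; the crux, STEP L′ (item 20498) and the sibling's crux 21398 stay OPEN at class
level. Part 21a (`…HeegnerKolyvaginSelfTwist.lean`, p573821) proved the Gross–Zagier bookkeeping identity
for the TWIST's `#Ш_an` when the PARAMETRISED curve `W` has analytic rank `0` and the twist `Wd = W^{(d_K)}`
analytic rank `1`, for ANY imaginary quadratic `K` with the Heegner hypothesis for `N_W` (`p ∣ d_K` allowed).
THIS FILE reads the two halves of Jetchev–Skinner–Wan 2017 §7.4 off it, for the twist: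

* `missingLowerBoundAt_twist_of_upper_of_indexBound` — LOWER(Wd) ⟸ UPPER(W) (rank `0`; in print off additive
  `p` with Borel-or-surjective image: Wuthrich 2014 Prop. 21) + the JSW inequality
  `2·v_p[W(K):ℤP] ≤ v_p #Ш(W/K) + v_p ∏c(W) + v_p ∏c(Wd)` for the PARAMETRISED curve (the shape of item
  20498 with curve and twist exchanged) + `ord_p u(Cd) = 0`. No Tamagawa condition.
* `missingUpperBoundAt_twist_of_kolyvagin_of_lower` — UPPER(Wd) ⟸ Kolyvagin 1990 Thm. A for `(W, K)` (tree
  fact `Kolyvagin1990_padicValNat_card_sha_le`, AS PRINTED by McCallum 1991 §1: `p` odd, `ρ̄_{W,p}` onto,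
  NO `p ∤ d_K`) + LOWER(W) + `p ∤ ∏c(W)·∏c(Wd)`.
* `bsdp_twist_of_indexBound_of_halves` — both: `BSD(Wd,p)`.

On cell (G-ord, `e = 2`) these are applied (Part 21c) with `W = V` the GOOD ordinary `p*`-twist of the
additive curve `E = Wd`, `K = ℚ(√−p)` (`p ≡ 3 (mod 4)`): the additive prime has left the curve.

References: [JetchevSkinnerWan2017] §7.4.1–7.4.2; [McCallumLMS1991] §1, §3 (p. 299); [GrossLMS1991] Prop. 2.1;
[KolyvaginEulerSystems1990] Thm. A; [Wuthrich2014] Prop. 21; [Miller2011LMS] Def. 1.1.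
-/

set_option autoImplicit false
set_option linter.dupNamespace false
noncomputable section

open scoped Classical NumberField
open WeierstrassCurve NumberField IsDedekindDomain
  Literature.NumberTheory.EllipticCurves Literature.NumberTheory.EllipticCurves.ModularForms
  Literature.NumberTheory.EllipticCurves.Rank1Residual
  Literature.NumberTheory.EllipticCurves.Rank1Residual.Typed
  Summit.BirchSwinnertonDyer.Rank1Residual
  Summit.BirchSwinnertonDyer.BirchSwinnertonDyer.Theorems.AnticyclotomicRankZero

namespace Summit.BirchSwinnertonDyer.BirchSwinnertonDyer.Theorems.AdditiveBranchIMCGordTwoRankOne.HeegnerKolyvagin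

/-! ### §2 The two halves of `BSD(E^{(d_K)},p)` for the TWIST of a rank-zero parametrised curve -/

/-- **THE LOWER HALF FOR THE TWIST from the JSW inequality for the PARAMETRISED rank-zero curve**
(Jetchev–Skinner–Wan 2017 §7.4.1 (eq:shalower), read for the other factor). Data as in
`exists_shaAn_twist_padicVal_eq_of_heegner_rankZero`, with `ord_p u(Cd) = 0` (`hu`), the UPPER half for
the rank-zero parametrised curve `W` (`hUW : MissingUpperBoundAt W p` — in print wherever `W` is not
additive at `p` with Borel-or-surjective image: Wuthrich 2014 Prop. 21, tree theorem
`Typed.missingUpperBoundAt_of_wuthrich`), and the STEP-L′-shaped input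
`hL : 2·v_p[W(K):ℤP] ≤ v_p #Ш(W/K) + v_p ∏c(W) + v_p ∏c(Wd)` (the inequality of item 20498 asked of
the frame `(W, K, P)`). CONCLUSION: `Typed.MissingLowerBoundAt Wd p` — `ord_p #Ш(E^{(d_K)})_an ≤
ord_p #Ш(E^{(d_K)})`. NO hypothesis on `d_K` versus `p`; no Tamagawa condition.
[cite: JetchevSkinnerWan2017, §7.4.1 (eq:shalowerK-1)–(eq:shalower), pp. 30–31] [cite: Miller2011LMS, Def. 1.1] -/
theorem missingLowerBoundAt_twist_of_upper_of_indexBound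
    (W : WeierstrassCurve ℚ) [W.IsElliptic] [W.IsGloballyMinimal] (p : ℕ) [Fact p.Prime]
    (N : ℕ) [NeZero N] (K : Type) [Field K] [NumberField K]
    (Dt : ModularParametrizationData W N) (H : HeegnerDatum N (NumberField.discr K)) (ι : K →+* ℂ)
    (P : (W.baseChange K).toAffine.Point)
    (hGZ : gross_zagier N W K) (hKo : kolyvagin N W K)
    (hGZK : rank_eq_analyticRank_of_analyticRank_le_one) (hmod : hasEntireLFunction_rat)
    (hK : IsImaginaryQuadratic K) (hHN : SatisfiesHeegnerHypothesis N K)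
    (hP : WeierstrassCurve.Affine.Point.map ι.toRatAlgHom P = heegnerPointComplex Dt H)
    (hp2 : p ≠ 2) (hc : ¬ (p : ℤ) ∣ Dt.c) (hμ : ¬ p ∣ Units.torsionOrder K)
    (hr : W.analyticRank = 0) (hUW : Typed.MissingUpperBoundAt W p)
    (Wd : WeierstrassCurve ℚ) [Wd.IsElliptic] [Wd.IsGloballyMinimal] (Cd : VariableChange ℚ)
    (hWd : Cd • W.quadraticTwist (NumberField.discr K : ℚ) = Wd)
    (hu : padicValRat p (Cd.u : ℚ) = 0) (hrd : Wd.analyticRank = 1)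
    (hL : Finite (W.baseChange K).sha →
      (2 * padicValNat p (AddSubgroup.zmultiples P).index : ℤ) ≤
        padicValNat p (W.baseChange K).shaOrder + padicValNat p W.tamagawaProduct +
          padicValNat p Wd.tamagawaProduct) :
    Typed.MissingLowerBoundAt Wd p := by
  obtain ⟨q', hq', hup⟩ := hUW
  obtain ⟨hqW, hvqW⟩ :=
    exists_centralValue_div_realPeriod_eq_of_shaAn_eq_rankZero hGZK hmod W p hr hq'
  obtain ⟨-, hfinK, hsha, q, hq, hval⟩ := exists_shaAn_twist_padicVal_eq_of_heegner_rankZero W p N K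
    Dt H ι P hGZ hKo hGZK hmod hK hHN hP hp2 hc hμ hr _ hqW Wd Cd hWd hrd
  refine ⟨q, hq, ?_⟩
  have e1 := hL hfinK
  have e2 : (padicValNat p (W.baseChange K).shaOrder : ℤ) =
      padicValNat p W.shaOrder + padicValNat p Wd.shaOrder := by exact_mod_cast hsha
  rw [hvqW, hu] at hval
  omega

/-- **THE UPPER HALF FOR THE TWIST from Kolyvagin's bound for the PARAMETRISED curve** (Jetchev–Skinner–Wan
2017 §7.4.2 (eq:shaupper), read for the other factor; Kolyvagin 1990 Thm. A as printed by McCallum 1991 §1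
— tree fact `Kolyvagin1990_padicValNat_card_sha_le`, binder `hKB`: `K` imaginary quadratic with the
Heegner hypothesis, `p` odd with `ρ̄_{E,p}` onto; NO hypothesis on `d_K` versus `p`). With the LOWER half
for the rank-zero parametrised curve `W` (`hLW : MissingLowerBoundAt W p`) and `p ∤ ∏c(W)·∏c(Wd)`:
`Typed.MissingUpperBoundAt Wd p`. [cite: JetchevSkinnerWan2017, §7.4.2 (eq:shaupper), p. 31]
[cite: McCallumLMS1991, §1 Theorem (Kolyvagin), p. 296] [cite: Miller2011LMS, Def. 1.1] -/
theorem missingUpperBoundAt_twist_of_kolyvagin_of_lower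
    (W : WeierstrassCurve ℚ) [W.IsElliptic] [W.IsGloballyMinimal] (p : ℕ) [Fact p.Prime]
    (N : ℕ) [NeZero N] (K : Type) [Field K] [NumberField K]
    (Dt : ModularParametrizationData W N) (H : HeegnerDatum N (NumberField.discr K)) (ι : K →+* ℂ)
    (P : (W.baseChange K).toAffine.Point)
    (hGZ : gross_zagier N W K) (hKo : kolyvagin N W K)
    (hKB : Kolyvagin1990_padicValNat_card_sha_le N W K)
    (hGZK : rank_eq_analyticRank_of_analyticRank_le_one) (hmod : hasEntireLFunction_rat)
    (hK : IsImaginaryQuadratic K) (hHN : SatisfiesHeegnerHypothesis N K)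
    (hP : WeierstrassCurve.Affine.Point.map ι.toRatAlgHom P = heegnerPointComplex Dt H)
    (hp2 : p ≠ 2) (hc : ¬ (p : ℤ) ∣ Dt.c) (hμ : ¬ p ∣ Units.torsionOrder K)
    (hsurj : W.HasSurjectiveModNGaloisRep p)
    (hr : W.analyticRank = 0) (hLW : Typed.MissingLowerBoundAt W p)
    (Wd : WeierstrassCurve ℚ) [Wd.IsElliptic] [Wd.IsGloballyMinimal] (Cd : VariableChange ℚ)
    (hWd : Cd • W.quadraticTwist (NumberField.discr K : ℚ) = Wd)
    (hu : padicValRat p (Cd.u : ℚ) = 0) (hrd : Wd.analyticRank = 1)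
    (htam : ¬ p ∣ W.tamagawaProduct) (htamd : ¬ p ∣ Wd.tamagawaProduct) :
    Typed.MissingUpperBoundAt Wd p := by
  obtain ⟨q', hq', hlow⟩ := hLW
  obtain ⟨hqW, hvqW⟩ :=
    exists_centralValue_div_realPeriod_eq_of_shaAn_eq_rankZero hGZK hmod W p hr hq'
  obtain ⟨-, hfinK, hsha, q, hq, hval⟩ := exists_shaAn_twist_padicVal_eq_of_heegner_rankZero W p N K
    Dt H ι P hGZ hKo hGZK hmod hK hHN hP hp2 hc hμ hr _ hqW Wd Cd hWd hrd
  -- the Heegner point has infinite order (`L(E,1) ≠ 0`, `L'(E^{(d_K)},1) ≠ 0`, Gross–Zagier)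
  have hD0 : (NumberField.discr K : ℚ) ≠ 0 := by exact_mod_cast NumberField.discr_ne_zero K
  haveI hEt : (W.quadraticTwist (NumberField.discr K : ℚ)).IsElliptic :=
    W.isElliptic_quadraticTwist hD0
  have hrt : (W.quadraticTwist (NumberField.discr K : ℚ)).analyticRank = 1 := by
    rw [← analyticRank_smul (W.quadraticTwist _) Cd, hWd, hrd]
  have hLt0 : (W.quadraticTwist (NumberField.discr K : ℚ)).entireLFunction 1 = 0 :=
    entireLFunction_one_eq_zero_of_analyticRank_eq_one hrt
  obtain ⟨-, hderivt⟩ := leadingLCoeff_eq_deriv_of_analyticRank_eq_one hrt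
  have hL1 : W.entireLFunction 1 ≠ 0 := (W.analyticRank_eq_zero_iff_holds (hmod W)).1 hr
  have hLK : LDerivEK W K ≠ 0 := by
    rw [lDerivEK_eq_mul_deriv hmod W K hLt0]; exact mul_ne_zero hL1 hderivt
  have hPH : IsHeegnerPoint N W K P := ⟨Dt, H, ι, hP⟩
  have hPinf : ¬ IsOfFinAddOrder P :=
    (lDerivEK_ne_zero_iff_not_isOfFinAddOrder W N K hGZ hK hHN hPH).mp hLK
  -- Kolyvagin's bound over `K`
  have hKU : padicValNat p (W.baseChange K).shaOrder ≤
      2 * padicValNat p (AddSubgroup.zmultiples P).index :=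
    hKB hK hHN hPH hPinf (Fact.out : p.Prime) hp2 hsurj
  refine ⟨q, hq, ?_⟩
  have h0 : padicValNat p W.tamagawaProduct = 0 := padicValNat.eq_zero_of_not_dvd htam
  have h0d : padicValNat p Wd.tamagawaProduct = 0 := padicValNat.eq_zero_of_not_dvd htamd
  have e1 : (padicValNat p (W.baseChange K).shaOrder : ℤ) ≤
      2 * padicValNat p (AddSubgroup.zmultiples P).index := by exact_mod_cast hKU
  have e2 : (padicValNat p (W.baseChange K).shaOrder : ℤ) =
      padicValNat p W.shaOrder + padicValNat p Wd.shaOrder := by exact_mod_cast hsha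
  have e3 : (padicValNat p W.tamagawaProduct : ℤ) = 0 := by exact_mod_cast h0
  have e4 : (padicValNat p Wd.tamagawaProduct : ℤ) = 0 := by exact_mod_cast h0d
  rw [hvqW, hu] at hval
  omega

/-- **`BSD(E^{(d_K)},p)` for the rank-one TWIST of a rank-zero parametrised curve, JSW shape**: both
halves (`missingLowerBoundAt_twist_of_upper_of_indexBound`, `missingUpperBoundAt_twist_of_kolyvagin_of_lower`)
from the JSW inequality for `(W, K, P)`, `BSD(W,p)` in its two halves, `p ∤ ∏c(W)∏c(Wd)`, Kolyvagin's
bound, and the PUBLISHED facts. [cite: JetchevSkinnerWan2017, §7.4 (pp. 29–31)] [cite: Miller2011LMS, Def. 1.1] -/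
theorem bsdp_twist_of_indexBound_of_halves
    (W : WeierstrassCurve ℚ) [W.IsElliptic] [W.IsGloballyMinimal] (p : ℕ) [Fact p.Prime]
    (N : ℕ) [NeZero N] (K : Type) [Field K] [NumberField K]
    (Dt : ModularParametrizationData W N) (H : HeegnerDatum N (NumberField.discr K)) (ι : K →+* ℂ)
    (P : (W.baseChange K).toAffine.Point)
    (hGZ : gross_zagier N W K) (hKo : kolyvagin N W K)
    (hKB : Kolyvagin1990_padicValNat_card_sha_le N W K)
    (hGZK : rank_eq_analyticRank_of_analyticRank_le_one) (hmod : hasEntireLFunction_rat)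
    (hK : IsImaginaryQuadratic K) (hHN : SatisfiesHeegnerHypothesis N K)
    (hP : WeierstrassCurve.Affine.Point.map ι.toRatAlgHom P = heegnerPointComplex Dt H)
    (hp2 : p ≠ 2) (hc : ¬ (p : ℤ) ∣ Dt.c) (hμ : ¬ p ∣ Units.torsionOrder K)
    (hsurj : W.HasSurjectiveModNGaloisRep p)
    (hr : W.analyticRank = 0) (hLW : Typed.MissingLowerBoundAt W p) (hUW : Typed.MissingUpperBoundAt W p)
    (Wd : WeierstrassCurve ℚ) [Wd.IsElliptic] [Wd.IsGloballyMinimal] (Cd : VariableChange ℚ)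
    (hWd : Cd • W.quadraticTwist (NumberField.discr K : ℚ) = Wd)
    (hu : padicValRat p (Cd.u : ℚ) = 0) (hrd : Wd.analyticRank = 1)
    (htam : ¬ p ∣ W.tamagawaProduct) (htamd : ¬ p ∣ Wd.tamagawaProduct)
    (hL : Finite (W.baseChange K).sha →
      (2 * padicValNat p (AddSubgroup.zmultiples P).index : ℤ) ≤
        padicValNat p (W.baseChange K).shaOrder + padicValNat p W.tamagawaProduct +
          padicValNat p Wd.tamagawaProduct) :
    BSDp Wd p :=
  Typed.bsdp_of_missingPPartAt Wd p hGZK (le_of_eq hrd)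
    (Typed.missingPPartAt_of_lower_of_upper Wd p
      (missingLowerBoundAt_twist_of_upper_of_indexBound W p N K Dt H ι P hGZ hKo hGZK hmod hK hHN hP hp2
        hc hμ hr hUW Wd Cd hWd hu hrd hL)
      (missingUpperBoundAt_twist_of_kolyvagin_of_lower W p N K Dt H ι P hGZ hKo hKB hGZK hmod hK hHN hP
        hp2 hc hμ hsurj hr hLW Wd Cd hWd hu hrd htam htamd))


end Summit.BirchSwinnertonDyer.BirchSwinnertonDyer.Theorems.AdditiveBranchIMCGordTwoRankOne.HeegnerKolyvagin

end
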